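import Mathlib
import HarnessLib
import Summits.FinalStateConjecture.Statement
import Summits.FinalStateConjecture.FinalStateConjecture.Theses.SwallowTheDatum
import Literature.Geometry.Lorentzian.KerrData
import Literature.Geometry.Lorentzian.Causality
import Literature.Geometry.Lorentzian.Geodesic

/-!
# Sketch — first lemmas of the round-2 crux idea cards (ideator 6) for
`SwallowTheDatum.KerrShieldedSettles` (item stmt-FinalStateConjecture-10054)

Nothing here is proved; each `def … : Prop` is the first checkable statement of one card and must
only elaborate (`lean check` rc 0, no sorry).  `bentHeight` is by `rfl` the route's hard-coded
height `T_{M,a}` (the lambda written into items 10052/10054/10055; cf. the standing disprover's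
`Cruxes/KerrShieldedSettles/Disproof.lean`, `bentHeight_eq_routeT`).

* card `convex-light-radius`      — `ConvexLightRadius`
* card `one-gauge-sliding-seam`   — `OneGaugeSeam`
* card `pinched-sandwich-cauchy`  — `PinchedSandwichCauchy`
-/

noncomputable section

namespace Summit.FinalStateConjecture.FinalStateConjecture.Cruxes.KerrShieldedSettles.Ideas6

open Literature.Geometry.Lorentzian Filter Topology Set
open scoped Manifold ContDiff

/-- Boyer–Lindquist height `F(r) = r* − r` up to a constant (`F′ = 2Mr/Δ`). -/
def blHeight (M a r : ℝ) : ℝ :=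
  (M / Real.sqrt (M ^ 2 - a ^ 2)) *
    (Kerr.rPlus M a * Real.log (r - Kerr.rPlus M a) - Kerr.rMinus M a * Real.log (r - Kerr.rMinus M a))

/-- The route's hard-coded bent height `T_{M,a}(r) = χ(r/4M − 1) · (F(r) − F(4M))`. -/
def bentHeight (M a : ℝ) : ℝ → ℝ := fun r =>
  Real.smoothTransition (r / (4 * M) - 1) * (blHeight M a r - blHeight M a (4 * M))

/-- `bentHeight` is definitionally the lambda of the route items. -/
theorem bentHeight_eq_routeT (M a : ℝ) :
    bentHeight M a = (fun r : ℝ => Real.smoothTransition (r / (4 * M) - 1) * (((M) / Real.sqrt ((M) ^ 2 - (a) ^ 2)) * (Literature.Geometry.Lorentzian.Kerr.rPlus M a * Real.log (r - Literature.Geometry.Lorentzian.Kerr.rPlus M a) - Literature.Geometry.Lorentzian.Kerr.rMinus M a * Real.log (r - Literature.Geometry.Lorentzian.Kerr.rMinus M a)) - ((M) / Real.sqrt ((M) ^ 2 - (a) ^ 2)) * (Literature.Geometry.Lorentzian.Kerr.rPlus M a * Real.log ((4 * M) - Literature.Geometry.Lorentzian.Kerr.rPlus M a) - Literature.Geometry.Lorentzian.Kerr.rMinus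 M a * Real.log ((4 * M) - Literature.Geometry.Lorentzian.Kerr.rMinus M a)))) :=
  rfl

/-! ## Card `convex-light-radius` -/

/-- **Convex light radius (first lemma).**  There is an absolute constant `C` such that for every
sub-extremal Kerr–Schild Kerr `(M, a)` and every NULL geodesic segment `γ` of `g_{M,a}` (ingoing
Kerr–Schild Cartesian chart `Kerr.region a r₁`, any inner radius `r₁`) which stays in the far zone
`{r ≥ C·M}` for affine parameters `t ∈ [t₁, t₂]`, the squared Euclidean coordinate radius
`t ↦ |x⃗(γ t)|²` is a CONVEX function of the affine parameter on `[t₁, t₂]`.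
Mechanism: the coordinate geodesic equation `ẍ = −Γ(ẋ, ẋ)` (`OpensChart.hasDerivAt_of_isGeodesicOn`)
with `|Γ| ≤ C′M/r²` (from `Kerr.abs_fderiv_scalarH_basisVector_le`,
`Kerr.abs_fderiv_nullVector_basisVector_le`, `|g⁻¹| ≤ 1 + 2M/r`) and the two-sided flat cone
sandwich for `g = η + 2Hℓ⊗ℓ`, `0 ≤ 2H ≤ 2M/r` (a `g`-null vector has `(1 − 8H) ṫ*² ≤ |ẋ⃗|² ≤ ṫ*²`)
give `(½|x⃗|²)¨ = |ẋ⃗|² + x⃗·ẍ⃗ ≥ ṫ*²(½ − 7C′M/r) > 0`.  No Killing field, no Carter constant, no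
principal-null structure is used; the statement is uniform in `|a| < M` and in the direction of
the ray.  It is the engine of the card: a convex radius cannot hover, so `∫ M/r² dt*` along any
far-zone ray is `≤ 4πC′M/R`, whence `ṫ*` stays within a factor `2` of its initial value for all
time (affine time ≍ Kerr–Schild time) and the sojourn clause follows by flat bookkeeping. -/
def ConvexLightRadius : Prop :=
  ∃ C : ℝ, 0 < C ∧
    ∀ [Kerr.Facts] (M a r₁ : ℝ), Kerr.IsSubextremal M a →
      ∀ [(Kerr.smoothMetric M a r₁).HasLeviCivita] (γ : ℝ → Kerr.region a r₁) (t₁ t₂ : ℝ),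
        t₁ ≤ t₂ →
        IsGeodesicOn (Kerr.smoothMetric M a r₁).leviCivita γ (Icc t₁ t₂) →
        (Kerr.smoothMetric M a r₁).IsNull (velocity 𝓘(ℝ, E4) γ t₁) →
        (∀ t ∈ Icc t₁ t₂, C * M ≤ Kerr.radius a (γ t : E4)) →
        ConvexOn ℝ (Icc t₁ t₂) (fun t => E4.spatialNorm (γ t : E4) ^ 2)

/-! ## Card `one-gauge-sliding-seam` -/

/-- The receding seam radius `R(s) = 2M + 2 + (1 + s²)^{1/4}` (smooth on `ℝ`, `> 2M ≥ r₊`,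
`R(s)/s → 0`, `R → ∞`); the excision radius of the flat domain is `ρ = R − 1`. -/
def seamRadius (M s : ℝ) : ℝ := 2 * M + 2 + (1 + s ^ 2) ^ (1 / 4 : ℝ)

/-- The height of the ONE temporal gauge: `h(s, r) = s + c₀ + T(r) · χ((r − 2R(s))/R(s))`,
`χ = Real.smoothTransition`.  The hole chart and the flat chart of the `N = 1` decomposition are
BOTH the map `Φ(s, x⃗) = χ_embed (h(s, r(x⃗)), x⃗)` restricted to their domains. -/
def gaugeHeight (M a c₀ s r : ℝ) : ℝ :=
  s + c₀ + bentHeight M a r * Real.smoothTransition ((r - 2 * seamRadius M s) / seamRadius M s)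

/-- **One gauge, sliding seam (first lemma).**  For every sub-extremal `(M, a)` there are a shift
`c₀` and a time `τ₀` such that on `{s ≥ τ₀}`: (i) `s ↦ h(s, r)` is strictly increasing for every
`r > r₊` (so `Φ` is injective and, with `∂ₛh > 0`, an open embedding of `{s > τ₀} × {r > r₊}`);
(ii) `h(s, r) ≥ T(r)` for every `r > r₊` (the image of `Φ` lies above the bent data slice
`{t* = T(r)}`, i.e. inside `D⁺(Σᵉ) ⊆ J⁺(ιX)` — the `IsLateChart.image_subset` worry of the route);
(iii) `h(s, r) = s + c₀` whenever `r ≤ 2R(s)` (on the growing near zone the gauge IS Kerr–Schild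
time translation, so the hole chart's truncated deviation vanishes identically with all
derivatives, uniformly on `{r ≤ R(s)}`).  Elementary real analysis on the explicit `T`:
`T ≥ 0`, `T` nondecreasing, `T(r) ≤ κ_a (2M log r + c)` (`κ_a = M/√(M² − a²)`), `χ′ ≤ 9/4`
(`Disproof.lean`, `STD.deriv_smoothTransition_le`), `R′/R = O(s⁻¹)`. -/
def OneGaugeSeam : Prop :=
  ∀ M a : ℝ, Kerr.IsSubextremal M a →
    ∃ c₀ τ₀ : ℝ,
      (∀ r, Kerr.rPlus M a < r → ∀ s₁ s₂, τ₀ ≤ s₁ → s₁ < s₂ →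
          gaugeHeight M a c₀ s₁ r < gaugeHeight M a c₀ s₂ r) ∧
      (∀ r, Kerr.rPlus M a < r → ∀ s, τ₀ ≤ s → bentHeight M a r ≤ gaugeHeight M a c₀ s r) ∧
      (∀ r s, τ₀ ≤ s → r ≤ 2 * seamRadius M s → gaugeHeight M a c₀ s r = s + c₀)

/-! ## Card `pinched-sandwich-cauchy` -/

/-- **Pinched sandwich (first lemma) — the bent leaf is a Cauchy hypersurface of an EXPLICIT
region, by three monotone clocks.**  For sub-extremal `(M, a)`, `0 ≤ M`, and a junction radius
`r₋ < r₁ < r₊` there is a collar depth `δ : ℝ → ℝ`, positive on `(r₁, ∞)` (intended: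
`δ` smooth, nondecreasing, `δ(r) ≤ (r − r₁)/8`, `δ′ ≤ 1/8`, `δ ≡ δ₀` on `[4M, ∞)`), such that in the
open sandwich `W = {x ∈ Kerr.region a r₁ | t*(x) > T(r(x)) − δ(r(x))}` of the ingoing Kerr–Schild
chart the bent leaf `Σᵉ = {t* = T(r)}` is met EXACTLY ONCE by every future-timelike curve lying
in `W` which has no endpoint in `W` (i.e. `Σᵉ` is a Cauchy hypersurface of the open submanifold
`(W, g_{M,a})` in the corrected sense `LorentzianMetric.IsCauchyHypersurface`).  Proof plan, all
kinematic: `u = t* − T(r)` and `û = u + δ(r)` are strictly increasing along future causal curves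
(the graphs are spacelike: `conormalSq_*_neg` of `Disproof.lean`, and `du(−g♯dt*) = 1 + 2H(1 + T′) > 0`);
`t*` is a time function (`Kerr.bilin_timeVector_timeVector_neg`); `|ẋ⃗| ≤ ṫ*` (light cones of
`g = η + 2Hℓ⊗ℓ` inside those of `η`, `KerrSchild.Background.coneCovector_causal`); on
`{r₁ < r ≤ r₊}` the radius strictly decreases along future timelike curves (`Δ ≤ 0`,
`dr(−g♯dt*) = −2H < 0`); `T ≥ 0`, `T ≡ 0` on `r ≤ 4M`, `T′ ≤ 1/3` on `r ≥ 8M`, `T → ∞`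
(`Disproof.lean` §B).  Past end above the leaf: `t* → −∞` forces `u < 0`; a finite `t*`-limit gives
a limit point on `∂W`, which is neither on the lower graph (`u ≥ 0` there is impossible) nor on the
inner edge (pastward `r` increases inside the hole).  Future end below the leaf: `t* → +∞` with
`u < 0` contradicts `T′ ≤ 1/3`; a finite limit on the lower graph contradicts `û ↑`; a limit on the
inner edge needs `Δt* ≥ (r − r₁)/(2√3)` (`|∂r| ≤ 2`) but only `δ(r) ≤ (r − r₁)/8` is available. -/
def PinchedSandwichCauchy : Prop :=
  ∀ [Kerr.Facts] (M a r₁ : ℝ) (hM : 0 ≤ M), Kerr.IsSubextremal M a →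
    Kerr.rMinus M a < r₁ → r₁ < Kerr.rPlus M a →
    ∃ δ : ℝ → ℝ, (∀ r, r₁ < r → 0 < δ r) ∧
      ∀ (γ : ℝ → Kerr.region a r₁) (s : Set ℝ), s.OrdConnected → s.Nonempty →
        (Kerr.smoothMetric M a r₁).IsFutureTimelikeCurveOn
            ((Kerr.timeOrientation M a r₁ hM).ofLE le_top) γ s →
        (∀ t ∈ s, bentHeight M a (Kerr.radius a (γ t : E4)) - δ (Kerr.radius a (γ t : E4)) <
            (γ t : E4) 0) →
        (∀ p : Kerr.region a r₁,
            bentHeight M a (Kerr.radius a (p : E4)) - δ (Kerr.radius a (p : E4)) < (p : E4) 0 →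
              ¬ HasFutureEndpoint γ s p) →
        (∀ p : Kerr.region a r₁,
            bentHeight M a (Kerr.radius a (p : E4)) - δ (Kerr.radius a (p : E4)) < (p : E4) 0 →
              ¬ HasPastEndpoint γ s p) →
        ∃! t, t ∈ s ∧ (γ t : E4) 0 = bentHeight M a (Kerr.radius a (γ t : E4))

end Summit.FinalStateConjecture.FinalStateConjecture.Cruxes.KerrShieldedSettles.Ideas6

end
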